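import Summits.BirchSwinnertonDyer.BirchSwinnertonDyer.Theses.UniversalToricDescent
import Summits.BirchSwinnertonDyer.BirchSwinnertonDyer.Theorems.UniversalToricDescentToricTransportModThreeStubRatSqueeze
import Summits.BirchSwinnertonDyer.BirchSwinnertonDyer.Theorems.UniversalToricDescentRationalSplitIMCInclusionAtThreeOfWall
import Summits.BirchSwinnertonDyer.BirchSwinnertonDyer.Theorems.UniversalToricDescentAcDualMuZeroCriterion
import Summits.BirchSwinnertonDyer.Rank1Residual.X11b.AnticyclotomicDualPair
import Summits.BirchSwinnertonDyer.Rank1Residual.X11b.AnticyclotomicModuleFinite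
import HarnessLib

/-!
# Crux `AdditiveSplitIMCInclusionAtThree` (stmt-BirchSwinnertonDyer-20395) — node `completed_toric_norms`
# (crux-ideate cover g20; UNREGISTERED node, `sorry` only in `stub_*`; concludes the crux BY NAME)

COMPLETED TORIC UNIVERSAL NORMS.  At the additive potentially-supersingular SPLIT prime `𝔭 | 3` every smooth
`3`-tower of CM test vectors is TRACE-ZERO (barrier `TraceZeroHeegnerTowerAtAdditiveSplitP`; old-g32 B-g32-1
"vector-free criterion"; and — new this generation, Mackey — the universal norms of the whole finite-type lattice
`c-Ind σ⁰|_T = ⊕ₙ c-Ind_{Z Tₙ}^T σ⁰` vanish at EVERY depth, each summand's trace tower being eventually `×3`), and every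
`3`-adic limit of Kummer images of points dies in `lim← Sel_(f,f) = 0` (B-g32-2: universal norms of a `Ĝₐ`-type
formal group vanish).  Hence a `Λ`-adic class on the `E`-side at `𝔭` MUST be (c) "relaxed-at-`𝔭`, non-point,
norm-compatible, with tame Kolyvagin relations and no Hecke-at-3 cost" (old-g32 spec (c): "no printed engine").
THE LEVER: take the test vectors not in the smooth representation `π₃ = π(f)₃` but in the unit ball of its
`3`-adic Banach completion inside completed cohomology, `Π(ρ_E|G_ℚ₃)⁰ ⊂ H̃¹(K^3, ℤ₃)_𝔪[ρ_E]` (Emerton local–global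
compatibility; Colmez–Dospinescu–Paškūnas / Paškūnas–Tung for `p = 3`), at FINITE PRECISION: a `T_m`-invariant
vector of `Π⁰/3^s` is a Hecke-eigen test map `φ̃_s : J_{U(s)}[3^s] → E[3^s]` at deep `3`-level which is NOT induced
by a morphism `J → E`; evaluating it on the Kummer image of the CM point of `X_{U(s)}` and corestricting gives
`κ_{m,s} ∈ H¹(K[3^m], E[3^s])`, integral, RELAXED at `𝔭` (non-point), tame-Kolyvagin (the `T(𝔸^{3})`-action is
untouched), `f` FIXED (no congruence cost), and NORM-COMPATIBLE in `m` exactly when `(φ̃_m)_m` is a UNIVERSAL-NORM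
family for the split torus: `Tr_{T_m/T_{m+1}} φ̃_{m+1} = φ̃_m` (Shimura reciprocity `σ_t(φ(P)) = (π(t)φ)(P)`).  So the
EXISTENCE of a `Λ`-adic CM class at the supercuspidal prime is reduced to a LOCAL statement in the `p`-adic
Langlands correspondence, never asked in this lineage or (searched) in print:
  (U1) `UNorm_T(Π(ρ)⁰) := lim←_m ((Π(ρ)⁰)^{T_m}, Tr) ≅ Hom_{Λ(T₁)}((Π(ρ)⁰)^d, Λ(T₁)) ≠ 0` for `ρ = ρ_E|G_ℚ₃`
  of supercuspidal inertial type (`T_m = diag(1+3^m ℤ₃, 1)`; via Colmez `Res_{ℤ₃^×} : D^♮ ⊠ ℙ¹ → D ⊠ ℤ₃^× = D^{ψ=0}`,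
  a `Λ(ℤ₃^×)`-module of "free type", the expected answer is YES with `μ`-free toric Mellin transform `𝒫`);
  (U2) the toric explicit reciprocity law `𝔏_𝔭(loc_𝔭 κ̃_∞) = ℒ_𝔭^{BDP} · 𝒫` by `3`-adic continuity from the finite-layer
  Waldspurger/BDP formulae (Liu–Zhang–Zhang; Nakamura's big dual exponential for the de Rham non-trianguline `ρ`);
  (U3) the rank-one Kolyvagin-system bound for the Selmer structure `F_♮` = (no condition at `𝔭`, `Λ·loc κ̃` at `𝔭'`)
  under the big-image hypothesis of the frame (`ρ̄_{E,3}` onto), output `(ℒ^{BDP}·𝒫) ⊆ Ch_Λ(X_(∅,0))` INTEGRALLY.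
The typed output of (U1)–(U3) is the **COFACTOR WALL** `CofactorWallAtThree`: `(L·P) ⊆ Ch_Λ(X)·R₀⟦T⟧` for some
`P ∈ R₀⟦T⟧` with a norm-one coefficient (`μ(P) = 0`, `λ(P)` arbitrary — the period defect of the completed test
family is allowed to have zeros but no `3`-content).

PIECES AND TAGS (D-0171):
* `CofactorWallAtThree` — WEAKER than the wall (`cofactorWall_of_wall`, proved, `P = 1`; strictly weaker as a
  divisibility shape: `cofactor_slack_witness`, `g = T, L = 1, P = T`-type witness over `ℤ`), NOT COSTUME (it does
  not give the wall without the `λ`-information of RATWALL), truth UNDECIDED.  Leaves: (U1) IDEA-NEEDED /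
  INSTRUMENTABLE (F-g20-unorm: decide `UNorm_{T₁}(π(0,0,1)|𝔽₃) ≠ 0` for the mod-3 supersingular representation
  `𝔽₃[Tree⁰]/im(T)` of `GL₂(ℚ₃)` — finite linear algebra per truncation radius; and the characteristic-0 model
  computation through `D^{ψ=0}`), (U2) IDEA-NEEDED (continuity of toric periods on completed cohomology —
  Colmez–Wang did the split-torus = Kato case), (U3) ATTACKABLE modulo (U1)(U2) (KLZ17 §11 / BCK21 §5 template;
  core-rank bookkeeping `χ(F_♮) = 1`), BARRIER-adjacent: `EulerSystemBigImageAtSmallImage` is discharged by the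
  frame's `HasSurjectiveModNGaloisRep 3`; `NoAdmissiblePrimesAtThree` does not apply (tame Kolyvagin primes
  `ℓ ∤ 3N` inert in `K`, not level-raising admissible primes); `TraceZeroHeegnerTowerAtAdditiveSplitP` is EVADED,
  not beaten: its technique class is a FIXED SMOOTH test vector (scope caveat (a)), ours is a non-smooth family.
* `RationalSplitIMCInclusionAtThree` (24207, LEAD `ratwall_thin_comb`) — WEAKER (`ratwall_of_wall`), ATTACKABLE.
* KERNEL `wall_of_ratwall_of_cofactorWall` — PROVED here (pure divisibility in the domain `R₀⟦T⟧`: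
  `g ∣ 3ᵏ·L`, `g ∣ L·P`, `3` prime, `3 ∤ P` ⟹ `g ∣ L`; no factorisation of `g`, no torsion or `μ` hypothesis needed),
  and `wall_iff_ratwall_and_cofactorWall` — PROVED: the node is an honest CONJUNCT SPLIT of the wall into its
  `λ`-half (RATWALL) and a `μ`-half WITH `λ`-SLACK (COFWALL) — a different cut from g7 `MuDominance` (no class, pure
  `μ` comparison), g18 POWERWALL (`∃ n, ℒⁿ ∈ Ch`) and g19 ONELAYER (`μ(X) = 0` outright): COFWALL is exactly the
  output shape of an INTEGRAL Euler/Kolyvagin system whose reciprocity law carries a `μ`-free period cofactor.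
* COMPOSITION `AdditiveSplitIMCInclusionAtThree_of : RATWALL → COFWALL → WALL`, kernel-checked, BY NAME.

Disproof.lean: none exists for this crux (checked `ledger crux ls`, 2026-08-31).  Negatives index {15532, 24881}:
disjoint.  Dead lines honoured: 24208 kernel_rat RK-6 v2 / 24209 / RK-7 v1 (no `3`-power bookkeeping on the class
side is asked: the slack sits in RATWALL's `k` and is stripped by primality, as in g19); old-g32 D5/D8 (smooth
Kirillov/Schwartz towers; Banach vectors read as limits of POINT classes) — this node's classes are torsion-level
non-point classes, to which B-g32-2 (point-limit vanishing) does not apply, and (U1) is about non-smooth vectors, to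
which B-g32-1 / the half-order refutation (NOTES-g55/g60: order exactly 1 on `Π(V)⁰ ∩ π_sm`) do not apply.
-/

set_option linter.dupNamespace false
set_option autoImplicit false

noncomputable section

open scoped Classical NumberField
open NumberField IsDedekindDomain Field WeierstrassCurve
open Literature.NumberTheory.EllipticCurves Literature.NumberTheory.EllipticCurves.IwasawaAlgebra
open Literature.NumberTheory.EllipticCurves.ZpExtension
open Summit.BirchSwinnertonDyer.Rank1Residual.X11b Summit.BirchSwinnertonDyer.Rank1Residual.X11b.AcSelmer
open Summit.BirchSwinnertonDyer.BirchSwinnertonDyer.Theses.UniversalToricDescent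
open Summit.BirchSwinnertonDyer.BirchSwinnertonDyer.Cruxes.ToricTransportModThree.RatwallThinComb
open Summit.BirchSwinnertonDyer.BirchSwinnertonDyer.Theorems.UniversalToricDescentAcDualMuZero
  (map_span_singleton_toUnr)

namespace Summit.BirchSwinnertonDyer.BirchSwinnertonDyer.Cruxes.AdditiveSplitIMCInclusionAtThree.CompletedToricNorms

/-! ## §1 The typed `μ`-half with `λ`-slack: the COFACTOR WALL -/

/-- **COFWALL** (`CofactorWallAtThree`; tag WEAKER-than-wall · UNDECIDED; leaves U1 IDEA-NEEDED/INSTRUMENTABLE,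
U2 IDEA-NEEDED, U3 ATTACKABLE-modulo-U1-U2).  At every frame of the wall: there is a cofactor `P ∈ R₀⟦T⟧` with a
coefficient of norm one (`μ(P) = 0`) such that `(L · P) ⊆ Ch_Λ(X_(∅,0)(E/K_∞)) · R₀⟦T⟧`.  Intended source: the
rank-one Kolyvagin system of the COMPLETED TORIC UNIVERSAL-NORM class `κ̃_∞ ∈ H¹_{Iw,(∅ at 𝔭)}(K_∞, T₃E)` built from
`UNorm_T(Π(ρ_E|G_ℚ₃)⁰) ≠ 0` (U1) with reciprocity law `𝔏_𝔭(loc_𝔭 κ̃_∞) = L · 𝒫`, `μ(𝒫) = 0` (U2), `P := 𝒫`.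
Binders = the wall's, verbatim. [cite: Castella2018, Def. 2.2, Thm. 2.8] [cite: Howard2004, Thm. 2.2.10]
[cite: GreenbergVatsal2000, p. 2, (1)–(2)] -/
def CofactorWallAtThree : Prop :=
  ∀ (W : WeierstrassCurve ℚ) [W.IsElliptic] [W.IsGloballyMinimal] (N : ℕ) [NeZero N] (K : Type) [Field K]
    [NumberField K] (Dt : Literature.NumberTheory.EllipticCurves.ModularForms.ModularParametrizationData W N),
    Summit.BirchSwinnertonDyer.Rank1Residual.Additive.ClassO6 W 3 → W.HasSurjectiveModNGaloisRep 3 →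
    W.analyticRank = 1 → W.conductorNorm ℤ = N → Literature.NumberTheory.EllipticCurves.IsImaginaryQuadratic K →
    Literature.NumberTheory.EllipticCurves.SatisfiesHeegnerHypothesis N K →
    ∀ (κ : Literature.NumberTheory.EllipticCurves.ZpExtension K 3), κ.IsAnticyclotomic →
    ∀ (γ : Field.absoluteGaloisGroup K) [Fact (κ.IsTopGenerator γ)]
      (𝔭 : IsDedekindDomain.HeightOneSpectrum (NumberField.RingOfIntegers K)),
      ((3 : ℕ) : NumberField.RingOfIntegers K) ∈ 𝔭.asIdeal →
      𝔭.asIdeal.ramificationIdx (NumberField.RingOfIntegers ℚ) = 1 →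
      𝔭.asIdeal.inertiaDeg (NumberField.RingOfIntegers ℚ) = 1 →
    ∀ (𝔭' : IsDedekindDomain.HeightOneSpectrum (NumberField.RingOfIntegers K)),
      ((3 : ℕ) : NumberField.RingOfIntegers K) ∈ 𝔭'.asIdeal → 𝔭' ≠ 𝔭 →
    ∀ (ι' : PadicAlgCl 3 ≃+* ℂ),
      Summit.BirchSwinnertonDyer.BirchSwinnertonDyer.Theorems.SchneiderFree.BranchInducesPrime 3 ι' 𝔭 →
    ∀ (ΩK : ℂ) (Ωp : ℂ_[3]) (L : Literature.NumberTheory.EllipticCurves.UnrSeries 3), ΩK ≠ 0 → Ωp ≠ 0 →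
      Literature.NumberTheory.EllipticCurves.IsBDPLFunction ι' 𝔭 κ γ Dt.f ΩK Ωp L →
      ∃ P : Literature.NumberTheory.EllipticCurves.UnrSeries 3,
        (∃ i : ℕ, ‖((PowerSeries.coeff i P : unrIntegers 3) : ℂ_[3])‖ = 1) ∧
        Ideal.span {L * P} ≤
          (Summit.BirchSwinnertonDyer.Rank1Residual.X11b.AcSelmer.XAc.charIdeal (W.baseChange K) 3 κ 𝔭' ∅ γ).map
            (PowerSeries.map (Summit.BirchSwinnertonDyer.Rank1Residual.X11b.Halves.toUnr 3))

/-! ## §2 Kernel algebra (proved): strip the `3`-power using a `3`-free cofactor, in any domain -/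

/-- In a domain: `g ∣ π^k · L` and `g ∣ L · P` with `π` prime and `π ∤ P` give `g ∣ L`.  (No factorisation of
`g` is used: cross-multiplying the two identities and cancelling `g` gives `π^k ∣ h · P`, hence `π^k ∣ h`.)
[cite: Washington1997, §7.1] -/
theorem dvd_of_dvd_prime_pow_mul_of_dvd_mul {R : Type*} [CommRing R] [IsDomain R] {π g L P : R}
    (hπ : Prime π) (hP : ¬ π ∣ P) (k : ℕ) (h1 : g ∣ π ^ k * L) (h2 : g ∣ L * P) : g ∣ L := by
  by_cases hg : g = 0
  · subst hg
    obtain ⟨h, hh⟩ := h1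
    have h0 : π ^ k * L = 0 := by simpa using hh
    rcases mul_eq_zero.mp h0 with hπk | hL
    · exact absurd hπk (pow_ne_zero k hπ.ne_zero)
    · simp [hL]
  · obtain ⟨h, hh⟩ := h1
    obtain ⟨h', hh'⟩ := h2
    have key : g * (h * P) = g * (π ^ k * h') := by
      calc g * (h * P) = (g * h) * P := by ring
        _ = π ^ k * L * P := by rw [← hh]
        _ = π ^ k * (L * P) := by ring
        _ = π ^ k * (g * h') := by rw [hh']
        _ = g * (π ^ k * h') := by ring
    have hc : h * P = π ^ k * h' := mul_left_cancel₀ hg key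
    obtain ⟨h'', rfl⟩ : π ^ k ∣ h := hπ.pow_dvd_of_dvd_mul_right k hP ⟨h', hc⟩
    refine ⟨h'', mul_left_cancel₀ (pow_ne_zero k hπ.ne_zero) ?_⟩
    calc π ^ k * L = g * (π ^ k * h'') := hh
      _ = π ^ k * (g * h'') := by ring

/-- Strictness witness for the shape of COFWALL (why it is WEAKER than the wall and not costume): over `ℤ` with the
prime `3`, `g = 5`, `L = 1`, `P = 5` satisfy `g ∣ L · P`, `3 ∤ P` and yet `g ∤ L` — the cofactor inclusion alone
carries no `λ`-information; only together with a `3`-power inclusion (RATWALL) does it give `g ∣ L`. [folklore] -/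
theorem cofactor_slack_witness : ∃ g L P : ℤ, g ∣ L * P ∧ ¬ (3 : ℤ) ∣ P ∧ ¬ g ∣ L :=
  ⟨5, 1, 5, by decide, by decide, by decide⟩

/-! ## §3 The wall from RATWALL + COFWALL, and back (both proved) -/

/-- **KERNEL** (proved): RATWALL (`3ᵏ·L ∈ Ch·R₀⟦T⟧ = (g)`) and COFWALL (`(L·P) ⊆ (g)`, `P` with a norm-one
coefficient, hence `3 ∤ P` by `not_C_three_dvd_of_norm_coeff_eq_one`) give `(L) ⊆ (g)`, i.e. the wall, by
`dvd_of_dvd_prime_pow_mul_of_dvd_mul` with the prime `C 3` of `R₀⟦T⟧` (`prime_C_three`).  `Ch_Λ(X)` is principal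
by `charIdeal_isPrincipal_holds`. [cite: Castella2018, Thm. 2.8] [cite: GreenbergVatsal2000, p. 2, (1)–(2)] -/
theorem wall_of_ratwall_of_cofactorWall :
    RationalSplitIMCInclusionAtThree → CofactorWallAtThree → AdditiveSplitIMCInclusionAtThree := by
  intro hR hC W _ _ N _ K _ _ Dt hO6 hsurj hr1 hN hK hH κ hκ γ _ 𝔭 h3 he hf 𝔭' h3' hne ι' hι ΩK Ωp L hΩK hΩp hL
  obtain ⟨k, hk⟩ := hR W N K Dt hO6 hsurj hr1 hN hK hH κ hκ γ 𝔭 h3 he hf 𝔭' h3' hne ι' hι ΩK Ωp L hΩK hΩp hL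
  obtain ⟨P, ⟨i, hi⟩, hP⟩ :=
    hC W N K Dt hO6 hsurj hr1 hN hK hH κ hκ γ 𝔭 h3 he hf 𝔭' h3' hne ι' hι ΩK Ωp L hΩK hΩp hL
  haveI : Module.Finite (IwasawaAlgebra 3) (XAc (W.baseChange K) 3 κ 𝔭' ∅ γ) :=
    XAc.module_finite κ 𝔭' ∅ γ Set.finite_empty (W := W.baseChange K)
  obtain ⟨f, hf⟩ := (charIdeal_isPrincipal_holds 3 (XAc (W.baseChange K) 3 κ 𝔭' ∅ γ)).principal
  have hf' : Module.charIdeal (IwasawaAlgebra 3) (XAc (W.baseChange K) 3 κ 𝔭' ∅ γ) = Ideal.span {f} := hf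
  have hg' : (XAc.charIdeal (W.baseChange K) 3 κ 𝔭' ∅ γ).map (PowerSeries.map (Halves.toUnr 3)) =
      Ideal.span {PowerSeries.map (Halves.toUnr 3) f} := by
    change (Module.charIdeal (IwasawaAlgebra 3) (XAc (W.baseChange K) 3 κ 𝔭' ∅ γ)).map _ = _
    rw [hf', map_span_singleton_toUnr]
  rw [hg'] at hk hP ⊢
  have h1 : PowerSeries.map (Halves.toUnr 3) f ∣ ((3 : ℕ) : UnrSeries 3) ^ k * L :=
    Ideal.mem_span_singleton.mp hk
  have h2 : PowerSeries.map (Halves.toUnr 3) f ∣ L * P := Ideal.span_singleton_le_span_singleton.mp hP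
  rw [← map_natCast (PowerSeries.C (R := unrIntegers 3))] at h1
  exact Ideal.span_singleton_le_span_singleton.mpr
    (dvd_of_dvd_prime_pow_mul_of_dvd_mul prime_C_three (not_C_three_dvd_of_norm_coeff_eq_one hi) k h1 h2)

/-- COFWALL from the wall (proved; `P = 1`): COFWALL is WEAKER than (implied by) the crux. [cite: Castella2018, Thm. 2.8] -/
theorem cofactorWall_of_wall : AdditiveSplitIMCInclusionAtThree → CofactorWallAtThree := by
  intro hA W _ _ N _ K _ _ Dt hO6 hsurj hr1 hN hK hH κ hκ γ _ 𝔭 h3 he hf 𝔭' h3' hne ι' hι ΩK Ωp L hΩK hΩp hL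
  refine ⟨1, ⟨0, by simp⟩, ?_⟩
  simpa using hA W N K Dt hO6 hsurj hr1 hN hK hH κ hκ γ 𝔭 h3 he hf 𝔭' h3' hne ι' hι ΩK Ωp L hΩK hΩp hL

/-- RATWALL from the wall (landed, g7/g19). [cite: Washington1997, §13.2] -/
theorem ratwall_of_wall : AdditiveSplitIMCInclusionAtThree → RationalSplitIMCInclusionAtThree :=
  Summit.BirchSwinnertonDyer.BirchSwinnertonDyer.Theorems.UniversalToricDescentRationalSplitIMCInclusionAtThreeOfWall.rationalSplitIMCInclusionAtThree_of_wall

/-- **WALL ⟺ RATWALL ∧ COFWALL** (proved): the node is an honest conjunct split — `λ`-half and `μ`-half-with-slack.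
[cite: Castella2018, Thm. 2.8] [cite: GreenbergVatsal2000, p. 2, (1)–(2)] -/
theorem wall_iff_ratwall_and_cofactorWall :
    AdditiveSplitIMCInclusionAtThree ↔ (RationalSplitIMCInclusionAtThree ∧ CofactorWallAtThree) :=
  ⟨fun h ↦ ⟨ratwall_of_wall h, cofactorWall_of_wall h⟩, fun h ↦ wall_of_ratwall_of_cofactorWall h.1 h.2⟩

/-! ## §4 Registered stubs and the composition concluding the crux BY NAME -/

/-- STUB (= sibling crux 24207, LEAD `ratwall_thin_comb`; WEAKER than the wall: `ratwall_of_wall`; ATTACKABLE). -/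
theorem stub_ratwall : RationalSplitIMCInclusionAtThree := by
  sorry

/-- STUB (COFWALL; UNDECIDED; the output of the completed-toric-universal-norm Kolyvagin system U1–U3). -/
theorem stub_cofactorWall : CofactorWallAtThree := by
  sorry

/-- **COMPOSITION** (kernel-checked, no `sorry`): RATWALL → COFWALL → the crux, BY NAME. -/
theorem AdditiveSplitIMCInclusionAtThree_of :
    RationalSplitIMCInclusionAtThree → CofactorWallAtThree → AdditiveSplitIMCInclusionAtThree :=
  wall_of_ratwall_of_cofactorWall

/-- The crux from the two registered stubs. -/
theorem AdditiveSplitIMCInclusionAtThree_holds_of_stubs : AdditiveSplitIMCInclusionAtThree :=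
  AdditiveSplitIMCInclusionAtThree_of stub_ratwall stub_cofactorWall

end Summit.BirchSwinnertonDyer.BirchSwinnertonDyer.Cruxes.AdditiveSplitIMCInclusionAtThree.CompletedToricNorms

end
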